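import Mathlib

/-!
# NE7BlockDefectSymbol — row NE7 (node U5), source route HOM (ROUTES-NE7.md §L1.1 K2a) feeding «PAIR-CAUCHY»: the K2a
# ABELIAN SYMBOL LEMMA in kernel — GLOBAL sign and GLOBAL quartic bound WITH THE SHARP CONSTANT `(L²−1)∕12` for the
# closed-form diagonal Bloch defect of the linearised block average (balaban-calc R-calc-40, note `NE7-P-HOM-1.md` §2)

Cell `pub-balaban`, rung (B)+1 sub-cell t4, lineage `b2b-balaban-t4-ne7-p2` (CRUX PROVER NE7 #2 under the coordinator
ruling «YM redirect», 2026-08-21; generation 50; texts `HOME/t4/b2b-balaban-t4-ne7-p2/g50/HOM-JUNCTION-NE7-P2.md` v2 §2,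
`g50/ROUTE2-NE7-P2.md` v1.5).  HONEST FRAMING (page 1): FIXED FINITE T⁴, rung (B)+1 = existence AND uniqueness of the
`ε = L^{−K} → 0` limit of unit-scale averaged expectations, CONDITIONAL on BetaPertH and the nine spine estimates (0/9
proved); NOT infinite volume, NOT a mass gap, NOT the Clay problem.  NE7 is NOT PRINTED in [Balaban1984PropagatorsI]–
[Balaban1989LargeFieldII] and NOT proved here.  Everything below is [folklore] (finite trigonometric sums, |sin nx| ≤ n|sin x|,
Lagrange's identity); no cite tag is used as a hypothesis, nothing printed is asserted, no `sorry`.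

THE OBJECT (state-and-source).  Route HOM's premise K2a is: the blocking defect `𝔇 = A_f∘U₁ − A_c` of the Wilson action
under ONE block-averaging step is IRRELEVANT (fourth order in momenta, with an explicit constant) and has a SIGN (Jensen).
Its registered symbol test P-HOM-1 (request NE7-L1-RC-1; balaban-calc lane cp-bal-e3c, R-calc-40 G13a, note
`run/shared/lean/ttrl/balaban-calc/notes/NE7-P-HOM-1.md` sha256 6cc9087f…, three independent codes agreeing to ≤ 1e−30)
computed, for Bałaban's block average of [Balaban1985Averaging] (14)∕(15)∕(42) LINEARISED and ABELIAN (tree contours with the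
reversed last piece, as kernel-formalised in `Literature…/B7Prop1Explicit.gammaWord` and as (48) requires; normalisation
`Q̂(0) = L·Id`; fine lattice `ℤ^d` spacing 1, coarse `Lℤ^d`, Wilson forms `½Σ(dA)²` with the same prefactor), the DIAGONAL
BLOCH BLOCK `d(p)` of `Δ1 = S_f − S_c∘Q` on plane waves `A_μ(x) = ε_μ e^{ip·x}` in CLOSED FORM (note §2):
  `ε†d(p)ε = Σ_{m<n} 2·h_mn(p)·|sin(p_n∕2)ε′_m − sin(p_m∕2)ε′_n|²`,  `ε′_m = e^{−ip_m∕2}ε_m`,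
  `h_mn(p) = 1 − g(p_m)·g(p_n)·Π_λ g(p_λ)`,  `g(q) = |L⁻¹Σ_{r<L} e^{iqr}|² = sin²(Lq∕2)∕(L² sin²(q∕2))`
(the tree-contour part of `Q` is an exact coarse pure gauge and drops out of the gauge-invariant form; only the straight
part `L·S(p)·s(p_κ)` survives).  The note certifies: order EXACTLY 4 at `p = 0`, `ε†dε ≥ 0`, and the LEADING-ORDER sup
`sup_u ‖Q4(u)‖∕|u|⁴ = (L²−1)∕12` («leading-order constant, not a global bound in p»).

WHAT THIS FILE AND ITS COMPANION PROVE (kernel, [folklore]) about exactly that closed form — with the phases `e^{−ip_m∕2}`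
absorbed into the polarisation (they do not change `|ε_m|`), written as the full double sum `Σ_m Σ_n` (= `2Σ_{m<n}`, `h`
symmetric, diagonal terms zero), over an ARBITRARY finite direction set `ι` (the constant is dimension-free).  THIS FILE
(part 1, the symbol and the weights):
§1 `abs_sin_nat_mul_le` (|sin(n x)| ≤ n|sin x|), `sin_sq_natSub_mul_le`, `one_sub_cos_eq`, range sums `sum_range_natCast`,
   `sum_range_natCast_sq`, `sum_sum_sub_sq` (`Σ_{r,r′<L}(r−r′)² = L²(L²−1)∕6`).
§2 the block symbol `gSym L q = ((Σ_{r<L}cos qr)² + (Σ_{r<L}sin qr)²)∕L²`: `cSum_sq_add_sSum_sq` (= `Σ_{r,r′}cos(q(r−r′))`),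
   `gSym_nonneg`, `gSym_le_one`, **`one_sub_gSym_le`** (`1 − g(q) ≤ ((L²−1)∕3)·sin²(q∕2)` — the Fejér bound, SHARP at
   leading order: `1 − g(q) = ((L²−1)∕12)q² + O(q⁴)`), and the identification **`fejer_identity`**
   (`(C² + S²)·sin²(q∕2) = sin²(Lq∕2)`, i.e. `g` IS the note's `g(q) = sin²(Lq∕2)∕(L²sin²(q∕2))` wherever `sin(q∕2) ≠ 0`;
   geometric sum in `ℂ`).
§3 the weights `hW L p m n = 1 − g(p_m)g(p_n)Π_λg(p_λ)`: `one_sub_prod_le_sum` (`1 − Πxᵢ ≤ Σ(1−xᵢ)` on `[0,1]`), `hW_nonneg`,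
   `hW_le_one`, **`hW_le`** (`h_mn ≤ ((L²−1)∕3)·(sin²(p_m∕2) + sin²(p_n∕2) + Σ_λ sin²(p_λ∕2))` — the note's `Q4` weights
   `|u|² + u_m² + u_n²` with their constant, globally).
THE COMPANION `Support/NE7BlockDefectSymbolBound` (part 2, the forms): `defectForm L p a = Σ_mΣ_n h_mn (sin(p_n∕2)a_m −
sin(p_m∕2)a_n)²` — **`defectForm_nonneg`** (the K2a ∕ P-HOM-1 ∕ LÖW-B1 SIGN, mode by mode) and **`defectForm_le`**:
`defectForm L p a ≤ ((L²−1)∕12)·(Σ_λ p_λ²)²·(Σ_m a_m²)` for ALL `p` (Lagrange's identity + `hW_le`) — the note's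
leading-order sup constant `(L²−1)∕12 = C(L)·a_c²`, `C(L) = (1−L⁻²)∕12`, promoted to a GLOBAL bound; the same on complex
polarisations (`defectFormC_le`); the scalar block-mean defect `scalarDefect_le` (`≤ ((L²−1)∕12)((Σp_μ²)² + Σp_μ⁴)`, the
planner's `D0` leading form as a bound) and the `d = 1` Laplacian defect `laplaceDefect_le` (`≤ ((L²−1)∕6)θ⁴`, the closed
form's leading coefficient, `g49/HOM-JUNCTION` §2).
WHAT IS NOT PROVED HERE.  The identification «this closed form = the diagonal Bloch block of `S_f − S_c∘Q` for the operator
(14)∕(48)» is balaban-calc's (sympy exact from the position-space definition, cross-checked by a raw-definition code and the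
planner's code) — NOT kernel; the umklapp blocks (note §5, order ≥ 3, controlled by smoothness not by the diagonal symbol),
the non-linear non-abelian defect `𝔇 = A − A∘Q` beyond linearisation at `U = 1` (K1-var(s) territory), and everything of
NE7.  Position-space companion already in the tree (straight-stencil average `B5Block118.QvOp`, Federbush's sign and a
fourth-order deficit bound with constant `6(d+2)n⁴`): `Literature…/T4AveragingDeficit` (`deficit_nonpos`, `abs_deficit_le'`)
— this file is the symbol-side certificate with the sharp constant.  NOT NE7 (spine 0/9 unchanged), NOT summit progress.
HONEST DEPENDENCY: continuum YM on T⁴ ⇐ BetaPertH ∧ nine spine estimates (0/9 proved); BetaPertH ⇐ (D1) ∧ (D4) ∧ CAP+tail;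
G-an2-4 gates asym, D1 and NE2/3/4.
-/

noncomputable section

open Finset Real
open scoped BigOperators

namespace Summit.QuantumFields.BalabanUV.T4Continuum.NE7BlockDefectSymbol

/-! ## §1 Trigonometric and arithmetic inputs -/

/-- `|sin (n x)| ≤ n |sin x|` for every natural `n` (addition formula + induction). [folklore] -/
theorem abs_sin_nat_mul_le (n : ℕ) (x : ℝ) : |sin (n * x)| ≤ n * |sin x| := by
  induction n with
  | zero => simp
  | succ n ih =>
    have e : sin (((n + 1 : ℕ) : ℝ) * x) = sin (n * x) * cos x + cos (n * x) * sin x := by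
      push_cast
      rw [add_mul, one_mul, sin_add]
    rw [e]
    have h1 : |sin (↑n * x) * cos x| ≤ |sin (↑n * x)| := by
      rw [abs_mul]
      exact mul_le_of_le_one_right (abs_nonneg _) (abs_cos_le_one x)
    have h2 : |cos (↑n * x) * sin x| ≤ |sin x| := by
      rw [abs_mul]
      exact mul_le_of_le_one_left (abs_nonneg _) (abs_cos_le_one _)
    calc |sin (↑n * x) * cos x + cos (↑n * x) * sin x|
        ≤ |sin (↑n * x) * cos x| + |cos (↑n * x) * sin x| := abs_add_le _ _
      _ ≤ n * |sin x| + |sin x| := by linarith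
      _ = ((n + 1 : ℕ) : ℝ) * |sin x| := by push_cast; ring

/-- Squared form: `sin (n x)² ≤ n² sin x²`. [folklore] -/
theorem sin_sq_nat_mul_le (n : ℕ) (x : ℝ) : sin (n * x) ^ 2 ≤ (n : ℝ) ^ 2 * sin x ^ 2 := by
  have h := abs_sin_nat_mul_le n x
  have h0 : 0 ≤ |sin (n * x)| := abs_nonneg _
  calc sin (n * x) ^ 2 = |sin (n * x)| ^ 2 := (sq_abs _).symm
    _ ≤ (n * |sin x|) ^ 2 := pow_le_pow_left₀ h0 h 2
    _ = (n : ℝ) ^ 2 * sin x ^ 2 := by rw [mul_pow, sq_abs]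

/-- Integer-difference form: `sin ((r − r′) y)² ≤ (r − r′)² sin y²` for naturals `r, r′`. [folklore] -/
theorem sin_sq_natSub_mul_le (r r' : ℕ) (y : ℝ) :
    sin (((r : ℝ) - r') * y) ^ 2 ≤ ((r : ℝ) - r') ^ 2 * sin y ^ 2 := by
  rcases le_total r' r with h | h
  · have e : ((r : ℝ) - r') = ((r - r' : ℕ) : ℝ) := by push_cast [Nat.cast_sub h]; ring
    rw [e]
    exact sin_sq_nat_mul_le _ _
  · have e : ((r : ℝ) - r') = -(((r' - r : ℕ) : ℝ)) := by push_cast [Nat.cast_sub h]; ring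
    rw [e, neg_mul, sin_neg, neg_sq, neg_sq]
    exact sin_sq_nat_mul_le _ _

/-- Half-angle: `1 − cos θ = 2 sin²(θ∕2)`. [folklore] -/
theorem one_sub_cos_eq (θ : ℝ) : 1 - cos θ = 2 * sin (θ / 2) ^ 2 := by
  have h1 := cos_two_mul (θ / 2)
  have h2 := sin_sq_add_cos_sq (θ / 2)
  rw [show 2 * (θ / 2) = θ by ring] at h1
  linarith

/-- `sin²(x∕2) ≤ x²∕4`. [folklore] -/
theorem sin_sq_half_le (x : ℝ) : sin (x / 2) ^ 2 ≤ x ^ 2 / 4 := by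
  have h : |sin (x / 2)| ≤ |x / 2| := abs_sin_le_abs
  have h0 : 0 ≤ |sin (x / 2)| := abs_nonneg _
  calc sin (x / 2) ^ 2 = |sin (x / 2)| ^ 2 := (sq_abs _).symm
    _ ≤ |x / 2| ^ 2 := pow_le_pow_left₀ h0 h 2
    _ = x ^ 2 / 4 := by rw [sq_abs]; ring

/-- `Σ_{r<L} r = L(L−1)∕2` in `ℝ`. [folklore] -/
theorem sum_range_natCast (L : ℕ) : ∑ r ∈ range L, (r : ℝ) = (L : ℝ) * (L - 1) / 2 := by
  induction L with
  | zero => simp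
  | succ L ih => rw [Finset.sum_range_succ, ih]; push_cast; ring

/-- `Σ_{r<L} r² = L(L−1)(2L−1)∕6` in `ℝ`. [folklore] -/
theorem sum_range_natCast_sq (L : ℕ) :
    ∑ r ∈ range L, (r : ℝ) ^ 2 = (L : ℝ) * (L - 1) * (2 * L - 1) / 6 := by
  induction L with
  | zero => simp
  | succ L ih => rw [Finset.sum_range_succ, ih]; push_cast; ring

/-- The second moment of the block differences: `Σ_{r<L} Σ_{r′<L} (r − r′)² = L²(L²−1)∕6`. [folklore] -/
theorem sum_sum_sub_sq (L : ℕ) :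
    ∑ r ∈ range L, ∑ r' ∈ range L, ((r : ℝ) - r') ^ 2 = (L : ℝ) ^ 2 * ((L : ℝ) ^ 2 - 1) / 6 := by
  have e : ∀ r r' : ℕ, ((r : ℝ) - r') ^ 2 = (r : ℝ) ^ 2 * 1 + 1 * (r' : ℝ) ^ 2 - 2 * ((r : ℝ) * r') := by
    intro r r'; ring
  have h1 : ∑ r ∈ range L, ∑ r' ∈ range L, (r : ℝ) ^ 2 * (1 : ℝ)
      = (∑ r ∈ range L, (r : ℝ) ^ 2) * ∑ r' ∈ range L, (1 : ℝ) := by rw [Finset.sum_mul_sum]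
  have h2 : ∑ r ∈ range L, ∑ r' ∈ range L, (1 : ℝ) * (r' : ℝ) ^ 2
      = (∑ r ∈ range L, (1 : ℝ)) * ∑ r' ∈ range L, (r' : ℝ) ^ 2 := by rw [Finset.sum_mul_sum]
  have h3 : ∑ r ∈ range L, ∑ r' ∈ range L, 2 * ((r : ℝ) * r')
      = 2 * ((∑ r ∈ range L, (r : ℝ)) * ∑ r' ∈ range L, (r' : ℝ)) := by
    rw [Finset.sum_mul_sum]; simp only [Finset.mul_sum]
  simp_rw [e, Finset.sum_sub_distrib, Finset.sum_add_distrib]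
  rw [h1, h2, h3, sum_range_natCast, sum_range_natCast_sq]
  simp only [Finset.sum_const, Finset.card_range, nsmul_eq_mul, mul_one]
  ring

/-! ## §2 The block symbol `g(q) = |L⁻¹ Σ_{r<L} e^{iqr}|²` -/

/-- `C_L(q) = Σ_{r<L} cos(q r)`. -/
def cSum (L : ℕ) (q : ℝ) : ℝ := ∑ r ∈ range L, cos (q * r)

/-- `S_L(q) = Σ_{r<L} sin(q r)`. -/
def sSum (L : ℕ) (q : ℝ) : ℝ := ∑ r ∈ range L, sin (q * r)

/-- The squared modulus of the block-sum symbol, normalised: `g_L(q) = ((Σ_{r<L}cos qr)² + (Σ_{r<L}sin qr)²)∕L² =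
|L⁻¹Σ_{r<L}e^{iqr}|²` (= `sin²(Lq∕2)∕(L²sin²(q∕2))` off the zeros of `sin(q∕2)`, `fejer_identity`). -/
def gSym (L : ℕ) (q : ℝ) : ℝ := (cSum L q ^ 2 + sSum L q ^ 2) / (L : ℝ) ^ 2

/-- `C² + S² = Σ_r Σ_{r′} cos(q(r − r′))`. [folklore] -/
theorem cSum_sq_add_sSum_sq (L : ℕ) (q : ℝ) :
    cSum L q ^ 2 + sSum L q ^ 2 = ∑ r ∈ range L, ∑ r' ∈ range L, cos (q * ((r : ℝ) - r')) := by
  unfold cSum sSum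
  rw [sq, sq, Finset.sum_mul_sum, Finset.sum_mul_sum, ← Finset.sum_add_distrib]
  refine Finset.sum_congr rfl fun r _ => ?_
  rw [← Finset.sum_add_distrib]
  refine Finset.sum_congr rfl fun r' _ => ?_
  rw [mul_sub, cos_sub]

/-- `0 ≤ g_L(q)`. [folklore] -/
theorem gSym_nonneg (L : ℕ) (q : ℝ) : 0 ≤ gSym L q := by
  unfold gSym; positivity

/-- `C² + S² ≤ L²`. [folklore] -/
theorem cSum_sq_add_sSum_sq_le (L : ℕ) (q : ℝ) : cSum L q ^ 2 + sSum L q ^ 2 ≤ (L : ℝ) ^ 2 := by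
  rw [cSum_sq_add_sSum_sq]
  calc ∑ r ∈ range L, ∑ r' ∈ range L, cos (q * ((r : ℝ) - r'))
      ≤ ∑ r ∈ range L, ∑ r' ∈ range L, (1 : ℝ) :=
        Finset.sum_le_sum fun r _ => Finset.sum_le_sum fun r' _ => cos_le_one _
    _ = (L : ℝ) ^ 2 := by simp [sq]

/-- `g_L(q) ≤ 1` (a mean of unimodular numbers has modulus ≤ 1). [folklore] -/
theorem gSym_le_one (L : ℕ) (q : ℝ) : gSym L q ≤ 1 := by
  unfold gSym
  rcases Nat.eq_zero_or_pos L with hL | hL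
  · subst hL; simp [cSum, sSum]
  · have hL2 : (0 : ℝ) < (L : ℝ) ^ 2 := by positivity
    rw [div_le_one hL2]
    exact cSum_sq_add_sSum_sq_le L q

/-- The deficit of the symbol in Fejér form: `L² − (C² + S²) = Σ_{r,r′} 2 sin²(q(r−r′)∕2) ≤ (L²(L²−1)∕3)·sin²(q∕2)`.
[folklore] -/
theorem sq_sub_cSum_sq_add_sSum_sq_le (L : ℕ) (q : ℝ) :
    (L : ℝ) ^ 2 - (cSum L q ^ 2 + sSum L q ^ 2) ≤ (L : ℝ) ^ 2 * ((L : ℝ) ^ 2 - 1) / 3 * sin (q / 2) ^ 2 := by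
  rw [cSum_sq_add_sSum_sq]
  have hlhs : ∑ r ∈ range L, ∑ r' ∈ range L, ((1 : ℝ) - cos (q * ((r : ℝ) - r')))
      = (L : ℝ) ^ 2 - ∑ r ∈ range L, ∑ r' ∈ range L, cos (q * ((r : ℝ) - r')) := by
    simp only [Finset.sum_sub_distrib, Finset.sum_const, Finset.card_range, nsmul_eq_mul, mul_one]
    ring
  rw [← hlhs]
  have key : ∀ r r' : ℕ, (1 : ℝ) - cos (q * ((r : ℝ) - r'))
      ≤ 2 * (((r : ℝ) - r') ^ 2 * sin (q / 2) ^ 2) := by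
    intro r r'
    rw [one_sub_cos_eq, show q * ((r : ℝ) - r') / 2 = ((r : ℝ) - r') * (q / 2) by ring]
    have := sin_sq_natSub_mul_le r r' (q / 2)
    linarith
  calc ∑ r ∈ range L, ∑ r' ∈ range L, ((1 : ℝ) - cos (q * ((r : ℝ) - r')))
      ≤ ∑ r ∈ range L, ∑ r' ∈ range L, 2 * (((r : ℝ) - r') ^ 2 * sin (q / 2) ^ 2) :=
        Finset.sum_le_sum fun r _ => Finset.sum_le_sum fun r' _ => key r r'
    _ = 2 * sin (q / 2) ^ 2 * ∑ r ∈ range L, ∑ r' ∈ range L, ((r : ℝ) - r') ^ 2 := by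
        rw [Finset.mul_sum]
        refine Finset.sum_congr rfl fun r _ => ?_
        rw [Finset.mul_sum]
        refine Finset.sum_congr rfl fun r' _ => ?_
        ring
    _ = (L : ℝ) ^ 2 * ((L : ℝ) ^ 2 - 1) / 3 * sin (q / 2) ^ 2 := by
        rw [sum_sum_sub_sq]; ring

/-- **FEJÉR BOUND (the sharp second-order control of the symbol).**  For `L ≥ 1`:
`1 − g_L(q) ≤ ((L²−1)∕3)·sin²(q∕2)` — at leading order `1 − g_L(q) = ((L²−1)∕12)q² + O(q⁴)` and
`((L²−1)∕3)sin²(q∕2) = ((L²−1)∕12)q² + O(q⁴)`, so the constant is sharp. [folklore] -/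
theorem one_sub_gSym_le {L : ℕ} (hL : 1 ≤ L) (q : ℝ) :
    1 - gSym L q ≤ ((L : ℝ) ^ 2 - 1) / 3 * sin (q / 2) ^ 2 := by
  have hLpos : (0 : ℝ) < (L : ℝ) ^ 2 := by
    have : (1 : ℝ) ≤ L := by exact_mod_cast hL
    positivity
  have h := sq_sub_cSum_sq_add_sSum_sq_le L q
  unfold gSym
  rw [show (1 : ℝ) - (cSum L q ^ 2 + sSum L q ^ 2) / (L : ℝ) ^ 2
      = ((L : ℝ) ^ 2 - (cSum L q ^ 2 + sSum L q ^ 2)) / (L : ℝ) ^ 2 by field_simp]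
  rw [div_le_iff₀ hLpos]
  calc (L : ℝ) ^ 2 - (cSum L q ^ 2 + sSum L q ^ 2)
      ≤ (L : ℝ) ^ 2 * ((L : ℝ) ^ 2 - 1) / 3 * sin (q / 2) ^ 2 := h
    _ = ((L : ℝ) ^ 2 - 1) / 3 * sin (q / 2) ^ 2 * (L : ℝ) ^ 2 := by ring

/-- `normSq (e^{iθ} − 1) = 4 sin²(θ∕2)`. [folklore] -/
theorem normSq_exp_mul_I_sub_one (θ : ℝ) :
    Complex.normSq (Complex.exp (θ * Complex.I) - 1) = 4 * sin (θ / 2) ^ 2 := by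
  rw [Complex.normSq_apply, Complex.sub_re, Complex.sub_im, Complex.exp_ofReal_mul_I_re,
    Complex.exp_ofReal_mul_I_im, Complex.one_re, Complex.one_im]
  have h1 := sin_sq_add_cos_sq θ
  have h2 := one_sub_cos_eq θ
  nlinarith [h1, h2]

/-- **FEJÉR IDENTITY (identification with the note's `g(q) = sin²(Lq∕2)∕(L²sin²(q∕2))`).**
`L²·sin²(q∕2)·g_L(q) = (C² + S²)·sin²(q∕2) = sin²(Lq∕2)` — the geometric sum `Σ_{r<L}e^{iqr}·(e^{iq} − 1) = e^{iqL} − 1`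
taken in squared modulus. [folklore] -/
theorem fejer_identity (L : ℕ) (q : ℝ) :
    (cSum L q ^ 2 + sSum L q ^ 2) * sin (q / 2) ^ 2 = sin (L * q / 2) ^ 2 := by
  -- the complex geometric sum
  set z : ℂ := Complex.exp (q * Complex.I) with hz
  have hsum : ∑ r ∈ range L, z ^ r = ∑ r ∈ range L, Complex.exp ((q * r : ℝ) * Complex.I) := by
    refine Finset.sum_congr rfl fun r _ => ?_
    rw [hz, ← Complex.exp_nat_mul]
    congr 1
    push_cast
    ring
  have hre : (∑ r ∈ range L, z ^ r).re = cSum L q := by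
    rw [hsum, Complex.re_sum]
    unfold cSum
    refine Finset.sum_congr rfl fun r _ => ?_
    rw [Complex.exp_ofReal_mul_I_re]
  have him : (∑ r ∈ range L, z ^ r).im = sSum L q := by
    rw [hsum, Complex.im_sum]
    unfold sSum
    refine Finset.sum_congr rfl fun r _ => ?_
    rw [Complex.exp_ofReal_mul_I_im]
  have hgeom : (∑ r ∈ range L, z ^ r) * (z - 1) = z ^ L - 1 := geom_sum_mul z L
  have hzL : z ^ L = Complex.exp (((L : ℝ) * q : ℝ) * Complex.I) := by
    rw [hz, ← Complex.exp_nat_mul]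
    congr 1
    push_cast
    ring
  have hn : Complex.normSq (∑ r ∈ range L, z ^ r) * Complex.normSq (z - 1) = Complex.normSq (z ^ L - 1) := by
    rw [← Complex.normSq_mul, hgeom]
  have hn1 : Complex.normSq (∑ r ∈ range L, z ^ r) = cSum L q ^ 2 + sSum L q ^ 2 := by
    rw [Complex.normSq_apply, hre, him]; ring
  have hn2 : Complex.normSq (z - 1) = 4 * sin (q / 2) ^ 2 := by
    rw [hz]; exact normSq_exp_mul_I_sub_one q
  have hn3 : Complex.normSq (z ^ L - 1) = 4 * sin ((L : ℝ) * q / 2) ^ 2 := by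
    rw [hzL]; exact normSq_exp_mul_I_sub_one _
  rw [hn1, hn2, hn3] at hn
  linarith

/-! ## §3 The weights `h_mn(p) = 1 − g(p_m) g(p_n) Π_λ g(p_λ)` -/

variable {ι : Type*} [Fintype ι] [DecidableEq ι]

/-- `1 − Π_{i∈s} xᵢ ≤ Σ_{i∈s} (1 − xᵢ)` for `xᵢ ∈ [0,1]`. [folklore] -/
theorem one_sub_prod_le_sum {α : Type*} [DecidableEq α] (s : Finset α) (x : α → ℝ)
    (h0 : ∀ i ∈ s, 0 ≤ x i) (h1 : ∀ i ∈ s, x i ≤ 1) :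
    1 - ∏ i ∈ s, x i ≤ ∑ i ∈ s, (1 - x i) := by
  induction s using Finset.induction_on with
  | empty => simp
  | @insert a s ha ih =>
    rw [Finset.prod_insert ha, Finset.sum_insert ha]
    have h0' : ∀ i ∈ s, 0 ≤ x i := fun i hi => h0 i (Finset.mem_insert_of_mem hi)
    have h1' : ∀ i ∈ s, x i ≤ 1 := fun i hi => h1 i (Finset.mem_insert_of_mem hi)
    have hP0 : 0 ≤ ∏ i ∈ s, x i := Finset.prod_nonneg h0'
    have hP1 : ∏ i ∈ s, x i ≤ 1 := Finset.prod_le_one h0' h1'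
    have ha0 : 0 ≤ x a := h0 a (Finset.mem_insert_self a s)
    have ha1 : x a ≤ 1 := h1 a (Finset.mem_insert_self a s)
    have ih' := ih h0' h1'
    nlinarith [mul_nonneg (sub_nonneg.2 ha1) (sub_nonneg.2 hP1)]

/-- The weight `h_mn(p) = 1 − g(p_m)·g(p_n)·Π_λ g(p_λ)` of the closed form (note §2). -/
def hW (L : ℕ) (p : ι → ℝ) (m n : ι) : ℝ :=
  1 - gSym L (p m) * gSym L (p n) * ∏ l, gSym L (p l)

omit [DecidableEq ι] in
/-- `0 ≤ Π_λ g(p_λ)`. [folklore] -/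
theorem prod_gSym_nonneg (L : ℕ) (p : ι → ℝ) : 0 ≤ ∏ l, gSym L (p l) :=
  Finset.prod_nonneg fun l _ => gSym_nonneg L (p l)

omit [DecidableEq ι] in
/-- `Π_λ g(p_λ) ≤ 1`. [folklore] -/
theorem prod_gSym_le_one (L : ℕ) (p : ι → ℝ) : ∏ l, gSym L (p l) ≤ 1 :=
  Finset.prod_le_one (fun l _ => gSym_nonneg L (p l)) fun l _ => gSym_le_one L (p l)

omit [DecidableEq ι] in
/-- `0 ≤ h_mn` (products of numbers in `[0,1]` are `≤ 1`). [folklore] -/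
theorem hW_nonneg (L : ℕ) (p : ι → ℝ) (m n : ι) : 0 ≤ hW L p m n := by
  unfold hW
  have a0 := gSym_nonneg L (p m); have a1 := gSym_le_one L (p m)
  have b0 := gSym_nonneg L (p n); have b1 := gSym_le_one L (p n)
  have c0 := prod_gSym_nonneg L p; have c1 := prod_gSym_le_one L p
  have hab : gSym L (p m) * gSym L (p n) ≤ 1 := by nlinarith
  have hab0 : 0 ≤ gSym L (p m) * gSym L (p n) := mul_nonneg a0 b0
  nlinarith

omit [DecidableEq ι] in
/-- `h_mn ≤ 1`. [folklore] -/
theorem hW_le_one (L : ℕ) (p : ι → ℝ) (m n : ι) : hW L p m n ≤ 1 := by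
  unfold hW
  have := mul_nonneg (mul_nonneg (gSym_nonneg L (p m)) (gSym_nonneg L (p n))) (prod_gSym_nonneg L p)
  linarith

/-- **THE WEIGHT BOUND** (the note's `Q4` weights, globally).  For `L ≥ 1`:
`h_mn(p) ≤ ((L²−1)∕3)·(sin²(p_m∕2) + sin²(p_n∕2) + Σ_λ sin²(p_λ∕2))`. [folklore] -/
theorem hW_le {L : ℕ} (hL : 1 ≤ L) (p : ι → ℝ) (m n : ι) :
    hW L p m n ≤ ((L : ℝ) ^ 2 - 1) / 3 *
      (sin (p m / 2) ^ 2 + sin (p n / 2) ^ 2 + ∑ l, sin (p l / 2) ^ 2) := by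
  -- three-factor splitting `1 − xyz ≤ (1−x) + (1−y) + (1−z)` on `[0,1]`
  have a0 := gSym_nonneg L (p m); have a1 := gSym_le_one L (p m)
  have b0 := gSym_nonneg L (p n); have b1 := gSym_le_one L (p n)
  have c0 := prod_gSym_nonneg L p; have c1 := prod_gSym_le_one L p
  have split : hW L p m n ≤ (1 - gSym L (p m)) + (1 - gSym L (p n)) + (1 - ∏ l, gSym L (p l)) := by
    unfold hW
    nlinarith [mul_nonneg (sub_nonneg.2 a1) (sub_nonneg.2 b1),
      mul_nonneg (sub_nonneg.2 c1) (sub_nonneg.2 (show gSym L (p m) * gSym L (p n) ≤ 1 by nlinarith)),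
      mul_nonneg a0 b0]
  have hm := one_sub_gSym_le hL (p m)
  have hn := one_sub_gSym_le hL (p n)
  have hprod : 1 - ∏ l, gSym L (p l) ≤ ((L : ℝ) ^ 2 - 1) / 3 * ∑ l, sin (p l / 2) ^ 2 := by
    calc 1 - ∏ l, gSym L (p l) ≤ ∑ l, (1 - gSym L (p l)) :=
          one_sub_prod_le_sum _ _ (fun l _ => gSym_nonneg L (p l)) fun l _ => gSym_le_one L (p l)
      _ ≤ ∑ l, ((L : ℝ) ^ 2 - 1) / 3 * sin (p l / 2) ^ 2 :=
          Finset.sum_le_sum fun l _ => one_sub_gSym_le hL (p l)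
      _ = ((L : ℝ) ^ 2 - 1) / 3 * ∑ l, sin (p l / 2) ^ 2 := by rw [Finset.mul_sum]
  calc hW L p m n ≤ (1 - gSym L (p m)) + (1 - gSym L (p n)) + (1 - ∏ l, gSym L (p l)) := split
    _ ≤ ((L : ℝ) ^ 2 - 1) / 3 * sin (p m / 2) ^ 2 + ((L : ℝ) ^ 2 - 1) / 3 * sin (p n / 2) ^ 2
        + ((L : ℝ) ^ 2 - 1) / 3 * ∑ l, sin (p l / 2) ^ 2 := by linarith
    _ = _ := by ring

end Summit.QuantumFields.BalabanUV.T4Continuum.NE7BlockDefectSymbol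

end
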